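import Summits.Ventures.HodgeRepro2.T5SplitHermitianClass

/-!
# The unitary group of a hermitian form over `(F × F, swap)` is the general linear group
(cell pub-hodge-repro2, seat p3)

Tier-5 N2 support, row N2.2.2 / §N2.7.2 (the SPLIT case) and route/T4-B1-p3.md's «U(V_v) ≅ GL₃(F⁺_v) at a place
`v` split in `E`»: over the split local algebra `F × F` with the swap involution (file 131), for a hermitian
`H = (A, Aᵀ)` with `IsUnit A.det`, a pair `g = (g₁, g₂)` is an isometry of `H` iff `g₂ᵀ A g₁ = A`
(`conjTranspose_mul_mul_eq_iff`); hence `g₂` is determined by `g₁` (`snd_eq_of_isometry`), `g₁` is invertible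
(`isUnit_det_fst_of_isometry`), and every invertible `g₁` extends uniquely to an isometry
(`exists_isometry_of_isUnit_det`, `isometry_fst_injective`): **the first projection is a bijection from the
isometry group `U(H)` onto `GL_n(F)`**, multiplicative (`isometry_fst_mul`). Mathlib + file 131 only.
No display; no device. §8(d): uses an L-value-free non-vanishing device: NO.
-/

namespace Summit.Ventures.HodgeRepro2.T5SplitUnitaryGroup

open Matrix Summit.Ventures.HodgeRepro2.T5SplitHermitianClass

variable {F : Type*} [CommRing F] {n : Type*} [Fintype n] [DecidableEq n]
variable (A : Matrix n n F)

/-- The hermitian matrix `(A, Aᵀ)` over `(F × F, swap)`. -/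
def hermitianPair : Matrix n n (F × F) := pairMatrix A Aᵀ

omit [Fintype n] [DecidableEq n] in
/-- `hermitianPair A` is hermitian for the swap star. -/
theorem isHermitian_hermitianPair :
    letI := swapStarRing F
    (hermitianPair A).IsHermitian := by
  letI := swapStarRing F
  show (hermitianPair A)ᴴ = hermitianPair A
  refine ext_of_map_fst_snd ?_ ?_
  · rw [conjTranspose_map_fst, hermitianPair, pairMatrix_map_snd, pairMatrix_map_fst, transpose_transpose]
  · rw [conjTranspose_map_snd, hermitianPair, pairMatrix_map_fst, pairMatrix_map_snd]

omit [DecidableEq n] in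
/-- **The isometry condition over `(F × F, swap)`:** `gᴴ H g = H` for `H = (A, Aᵀ)` iff `g₂ᵀ A g₁ = A`. -/
theorem conjTranspose_mul_mul_eq_iff (g : Matrix n n (F × F)) :
    letI := swapStarRing F
    gᴴ * hermitianPair A * g = hermitianPair A ↔ (g.map Prod.snd)ᵀ * A * g.map Prod.fst = A := by
  letI := swapStarRing F
  constructor
  · intro h
    have h1 := congrArg (Matrix.map · Prod.fst) h
    rwa [map_fst_mul, map_fst_mul, conjTranspose_map_fst, hermitianPair, pairMatrix_map_fst] at h1
  · intro h
    have h' := congrArg transpose h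
    rw [transpose_mul, transpose_mul, transpose_transpose] at h'
    refine ext_of_map_fst_snd ?_ ?_
    · rw [map_fst_mul, map_fst_mul, conjTranspose_map_fst, hermitianPair, pairMatrix_map_fst, h]
    · rw [map_snd_mul, map_snd_mul, conjTranspose_map_snd, hermitianPair, pairMatrix_map_snd, Matrix.mul_assoc]
      exact h'

variable (hA : IsUnit A.det)

include hA in
/-- An isometry of `(A, Aᵀ)` has invertible first component. -/
theorem isUnit_det_fst_of_isometry (g : Matrix n n (F × F))
    (hg : letI := swapStarRing F; gᴴ * hermitianPair A * g = hermitianPair A) :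
    IsUnit (g.map Prod.fst).det := by
  have h := (conjTranspose_mul_mul_eq_iff A g).mp hg
  have hdet : ((g.map Prod.snd)ᵀ * A * g.map Prod.fst).det = A.det := by rw [h]
  rw [det_mul, det_mul] at hdet
  exact isUnit_of_mul_isUnit_right (hdet ▸ hA)

include hA in
/-- **The second component of an isometry is determined by the first:** `g₂ = (A g₁⁻¹ A⁻¹)ᵀ`. -/
theorem snd_eq_of_isometry (g : Matrix n n (F × F))
    (hg : letI := swapStarRing F; gᴴ * hermitianPair A * g = hermitianPair A) :
    g.map Prod.snd = (A * (g.map Prod.fst)⁻¹ * A⁻¹)ᵀ := by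
  have h := (conjTranspose_mul_mul_eq_iff A g).mp hg
  have h1 := isUnit_det_fst_of_isometry A hA g hg
  have h2 : (g.map Prod.snd)ᵀ = A * (g.map Prod.fst)⁻¹ * A⁻¹ := by
    calc (g.map Prod.snd)ᵀ = (g.map Prod.snd)ᵀ * A * g.map Prod.fst * (g.map Prod.fst)⁻¹ * A⁻¹ := by
          rw [Matrix.mul_assoc _ (g.map Prod.fst), Matrix.mul_nonsing_inv _ h1, Matrix.mul_one,
            Matrix.mul_assoc, Matrix.mul_nonsing_inv A hA, Matrix.mul_one]
      _ = A * (g.map Prod.fst)⁻¹ * A⁻¹ := by rw [h]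
  rw [← h2, transpose_transpose]

include hA in
/-- **Every invertible `g₁` extends to an isometry** `(g₁, (A g₁⁻¹ A⁻¹)ᵀ)` of `(A, Aᵀ)`. -/
theorem exists_isometry_of_isUnit_det (g₁ : Matrix n n F) (h₁ : IsUnit g₁.det) :
    letI := swapStarRing F
    (pairMatrix g₁ (A * g₁⁻¹ * A⁻¹)ᵀ)ᴴ * hermitianPair A * pairMatrix g₁ (A * g₁⁻¹ * A⁻¹)ᵀ = hermitianPair A := by
  rw [conjTranspose_mul_mul_eq_iff, pairMatrix_map_snd, pairMatrix_map_fst, transpose_transpose,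
    Matrix.mul_assoc (A * g₁⁻¹), Matrix.mul_assoc A, Matrix.nonsing_inv_mul A hA, Matrix.mul_one,
    Matrix.mul_assoc, Matrix.nonsing_inv_mul g₁ h₁, Matrix.mul_one]

include hA in
/-- **The first projection is injective on isometries.** -/
theorem isometry_fst_injective (g g' : Matrix n n (F × F))
    (hg : letI := swapStarRing F; gᴴ * hermitianPair A * g = hermitianPair A)
    (hg' : letI := swapStarRing F; g'ᴴ * hermitianPair A * g' = hermitianPair A)
    (h : g.map Prod.fst = g'.map Prod.fst) : g = g' :=
  ext_of_map_fst_snd h (by rw [snd_eq_of_isometry A hA g hg, snd_eq_of_isometry A hA g' hg', h])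

omit [DecidableEq n] in
/-- The first projection is multiplicative. -/
theorem isometry_fst_mul (g g' : Matrix n n (F × F)) :
    (g * g').map Prod.fst = g.map Prod.fst * g'.map Prod.fst :=
  map_fst_mul g g'

end Summit.Ventures.HodgeRepro2.T5SplitUnitaryGroup
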